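import Summits.AtomisticToContinuum.Crystallization.Theorems.FreeSplittingCertificatesStrictSplittingRuleTorusModelGen

/-!
# The DUAL side of the torus joint LMI: no transfer family can beat a negative site-SUM (weak duality of the transfer LP)

Route `FreeSplittingCertificates`, crux `StrictSplittingRule` (stmt-AtomisticToContinuum-12560); unit b2b-freesplit-B (block 2b,
PART B, gen 2).  **VALUE = theorems about a FINITE model (a decidable, two-sided verdict on the feasibility factor of the torus
LMI) — NOT summit progress**; the registered stub `stub_coreJointCoercive` (H12⋆) is neither proved nor refuted here.

Gens 0–1 certified the PRIMAL side: explicit transfer tables making the sitewise inequality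
`λ·K_p(u) + R_p(u) + m‖u‖² ≤ S_p(u) + T_p(u) + meanProj(u)` hold at every site of the hcp tori (CERT.md §0, §8b, §9).  This file is
the DUAL side.  The transfers of the certificate format are ANTISYMMETRIC between the two sites of a pair, so they cancel in the sum
over all sites of the torus: `Σ_p T_p(u) = 0` for every `u` (for the landed 4×4×2 tables this is the checked theorem
`transfer_sum_zero`; for pair-indexed transfers in general it is `sum_pairTransfer_eq_zero` below).  Hence, summing the sitewise
inequality over `p`: if for some displacement field `u`
`Σ_p [S_p(u) + meanProj(u) − λ·K_p(u) − R_p(u)] < 0`   (`siteBalance`, transfer-free and table-free),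
then for EVERY zero-sum transfer assignment `T` some site `p` violates the `λ`-scaled inequality even with margin `m = 0`
(`exists_deficit_of_siteSum_neg`, `not_jointLMI_of_siteSum_neg`).  The premise is decidable rational arithmetic on an explicit
witness field; instances (with the witness found by Bloch reduction of the site-sum form) are in the `…TorusModel663Dual*` files.

Generic in the torus shape `(NK, N1)`; the forms `supplyS / kappaS / readoutS / meanProjS / normSqS` are the term-list forms of
`…TorusModelGen.lean` evaluated (`supplyS 4 5 = supply5` etc. definitionally).  Also: `allSitesG_sum` (the site list sums like
`Finset.univ`), `layerSitesG` / `allSitesG_sum_layers` (layer-wise splitting of a site sum, used to spread the evaluation of a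
witness over several files).  [folklore: weak LP duality / Farkas]
-/

namespace Summit.AtomisticToContinuum.Crystallization.Theorems.StrictSplittingRuleTorusLMI

open Literature.Computation.Certificates

section Shape

variable (NK N1 : ℕ) [NeZero NK] [NeZero N1]

/-- SUPPLY `S_p(u)` on the torus of shape `(NK, N1)` (term-list form of `…TorusModelGen`, evaluated). [folklore] -/
def supplyS (p : SiteG NK N1) (u : Fin (dimG NK N1) → ℚ) : ℚ := evalQ (supplyTermsG NK N1 p (thetaListG NK N1 p)) u
/-- κ-DEMAND `K_p(u) = κ₁Σ⟨V s, e_s⟩² + κ₃Σ‖e_s − W V s‖²` (unscaled, `(κ₁, κ₃) = (1/3, 1/12)`). [folklore] -/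
def kappaS (p : SiteG NK N1) (u : Fin (dimG NK N1) → ℚ) : ℚ := evalQ (kappaTermsG NK N1 p (thetaListG NK N1 p)) u
/-- READOUT FORM `R_p(u)` (line-truss `β` data `betaTable`). [folklore] -/
def readoutS (p : SiteG NK N1) (u : Fin (dimG NK N1) → ℚ) : ℚ :=
  evalQ (readoutTermsG NK N1 p (thetaListG NK N1 p) betaTable) u
/-- `meanProj u = Σ_c (g_c/|T|)(Σ_q u_(q,c))²` (vanishes on zero-mean fields). [folklore] -/
def meanProjS (u : Fin (dimG NK N1) → ℚ) : ℚ := evalQ (projTermsG NK N1) u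
/-- `‖u‖²_G` (Cartesian norm in the scaled frame). [folklore] -/
def normSqS (u : Fin (dimG NK N1) → ℚ) : ℚ := evalQ (normTermsG NK N1) u

/-- The transfer-free SITE BALANCE at scaling `λ`: `S_p(u) + meanProj(u) − λ·K_p(u) − R_p(u)`. [folklore] -/
def siteBalance (lam : ℚ) (p : SiteG NK N1) (u : Fin (dimG NK N1) → ℚ) : ℚ :=
  supplyS NK N1 p u + meanProjS NK N1 u - lam * kappaS NK N1 p u - readoutS NK N1 p u

/-! ### Site sums: the list `allSitesG` versus `Finset.univ`, and layer-wise splitting -/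

/-- Summing a map over a `flatMap`, in any additive monoid (local copy of a folklore helper; `private` so that it is not
re-exported next to the identical helpers of unrelated modules). [folklore] -/
private theorem sum_map_flatMap {α β M : Type*} [AddMonoid M] (l : List α) (f : α → List β) (g : β → M) :
    ((l.flatMap f).map g).sum = (l.map fun a => ((f a).map g).sum).sum := by
  induction l with
  | nil => simp
  | cons a l ih => simp [List.flatMap_cons, List.map_append, List.sum_append, ih]

/-- The sites of layer `k`, in the order of `allSitesG`. [folklore] -/
def layerSitesG (k : Fin NK) : List (SiteG NK N1) :=
  (List.finRange N1).flatMap fun i => (List.finRange N1).map fun j => (k, i, j)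

omit [NeZero NK] [NeZero N1] in
/-- `allSitesG` is the concatenation of its layers. [folklore] -/
theorem allSitesG_eq_flatMap_layers : allSitesG NK N1 = (List.finRange NK).flatMap (layerSitesG NK N1) := rfl

omit [NeZero NK] [NeZero N1] in
/-- A sum over the sites of one layer is the `Finset` sum over `Fin N1 × Fin N1`. [folklore] -/
theorem layerSitesG_sum (k : Fin NK) (g : SiteG NK N1 → ℚ) :
    ((layerSitesG NK N1 k).map g).sum = ∑ ij : Fin N1 × Fin N1, g (k, ij) := by
  rw [Fintype.sum_prod_type, Fin.sum_univ_def, layerSitesG, sum_map_flatMap]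
  congr 1
  refine List.map_congr_left fun i _ => ?_
  rw [Fin.sum_univ_def, List.map_map]
  rfl

omit [NeZero NK] [NeZero N1] in
/-- **A site sum over the list `allSitesG` is the sum over `Finset.univ`.** [folklore] -/
theorem allSitesG_sum (g : SiteG NK N1 → ℚ) : ((allSitesG NK N1).map g).sum = ∑ q : SiteG NK N1, g q := by
  rw [Fintype.sum_prod_type, Fin.sum_univ_def, allSitesG_eq_flatMap_layers, sum_map_flatMap]
  congr 1
  refine List.map_congr_left fun k _ => ?_
  rw [layerSitesG_sum]

omit [NeZero NK] [NeZero N1] in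
/-- Layer-wise splitting of a site sum: `Σ_q g q = Σ_k Σ_{q ∈ layer k} g q`. [folklore] -/
theorem allSitesG_sum_layers (g : SiteG NK N1 → ℚ) :
    ∑ q : SiteG NK N1, g q = ∑ k : Fin NK, ((layerSitesG NK N1 k).map g).sum := by
  rw [← allSitesG_sum, allSitesG_eq_flatMap_layers, sum_map_flatMap, Fin.sum_univ_def]

/-! ### Weak duality: a negative site sum defeats every zero-sum transfer family -/

/-- **Dual certificate ⇒ a violated site.**  If the transfer-free site balances at scaling `λ` sum to a negative number for
the field `u`, then for every transfer assignment `T` with `Σ_p T_p(u) = 0` some site `p` has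
`S_p(u) + T_p(u) + meanProj(u) < λ·K_p(u) + R_p(u)`. [folklore: weak LP duality] -/
theorem exists_deficit_of_siteSum_neg (lam : ℚ) (u : Fin (dimG NK N1) → ℚ)
    (T : SiteG NK N1 → (Fin (dimG NK N1) → ℚ) → ℚ) (hT : ∑ p, T p u = 0)
    (hneg : ∑ p, siteBalance NK N1 lam p u < 0) :
    ∃ p : SiteG NK N1, supplyS NK N1 p u + T p u + meanProjS NK N1 u < lam * kappaS NK N1 p u + readoutS NK N1 p u := by
  have h1 : ∑ p, (supplyS NK N1 p u + T p u + meanProjS NK N1 u) =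
      ∑ p, siteBalance NK N1 lam p u + ∑ p, (lam * kappaS NK N1 p u + readoutS NK N1 p u) + ∑ p, T p u := by
    rw [← Finset.sum_add_distrib, ← Finset.sum_add_distrib]
    refine Finset.sum_congr rfl fun p _ => ?_
    simp only [siteBalance]
    ring
  have hlt : ∑ p, (supplyS NK N1 p u + T p u + meanProjS NK N1 u) < ∑ p, (lam * kappaS NK N1 p u + readoutS NK N1 p u) := by
    rw [h1, hT]
    linarith
  obtain ⟨p, -, hp⟩ := Finset.exists_lt_of_sum_lt hlt
  exact ⟨p, hp⟩

/-- **No zero-sum transfer family rescues the `λ`-scaled sitewise LMI** (margin `0`) once a field with negative site sum exists.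
[folklore: weak LP duality] -/
theorem not_jointLMI_of_siteSum_neg (lam : ℚ) (u : Fin (dimG NK N1) → ℚ)
    (hneg : ∑ p, siteBalance NK N1 lam p u < 0)
    (T : SiteG NK N1 → (Fin (dimG NK N1) → ℚ) → ℚ) (hT : ∑ p, T p u = 0) :
    ¬ ∀ (p : SiteG NK N1) (v : Fin (dimG NK N1) → ℚ),
        lam * kappaS NK N1 p v + readoutS NK N1 p v ≤ supplyS NK N1 p v + T p v + meanProjS NK N1 v := by
  intro h
  obtain ⟨p, hp⟩ := exists_deficit_of_siteSum_neg NK N1 lam u T hT hneg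
  exact absurd (h p u) (not_le.mpr hp)

end Shape

/-- **Pair-indexed antisymmetrised transfers sum to zero**: `Σ_p Σ_q (X p q − X q p) = 0` — the format of the certificate's
transfers (`+X` at the first site of a pair, `−X` at its partner; the `(M, N)` tables of `CoreJointCoercive`). [folklore] -/
theorem sum_pairTransfer_eq_zero {ι : Type*} [Fintype ι] (X : ι → ι → ℚ) : ∑ p, ∑ q, (X p q - X q p) = 0 := by
  simp only [Finset.sum_sub_distrib]
  rw [Finset.sum_comm]
  exact sub_self _

/-- Weak duality for pair-indexed transfers: a negative site sum defeats every family `X p q u` of pair contributions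
placed antisymmetrically. [folklore] -/
theorem exists_deficit_of_siteSum_neg_pair (NK N1 : ℕ) [NeZero NK] [NeZero N1] (lam : ℚ) (u : Fin (dimG NK N1) → ℚ)
    (X : SiteG NK N1 → SiteG NK N1 → (Fin (dimG NK N1) → ℚ) → ℚ) (hneg : ∑ p, siteBalance NK N1 lam p u < 0) :
    ∃ p : SiteG NK N1, supplyS NK N1 p u + ∑ q, (X p q u - X q p u) + meanProjS NK N1 u <
      lam * kappaS NK N1 p u + readoutS NK N1 p u :=
  exists_deficit_of_siteSum_neg NK N1 lam u (fun p v => ∑ q, (X p q v - X q p v)) (sum_pairTransfer_eq_zero fun p q => X p q u)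
    hneg

/-! ### A fast evaluator of site-balance sums (proved equal to the term-list definition)

Evaluating `siteBalance` directly costs several seconds per site: every one of the ~5 000 terms of a site rebuilds the
co-rotation functional as a merged coordinate list, and every readout term searches the 3 112-row `β` table.  The evaluator below
hoists everything that does not depend on the site or on `u` into per-parity PLANS computed once (offsets, relative positions,
rounded Lennard-Jones weights, `β` values), computes the three rotation parameters `θ_k(u)` of a site once, and then spends a few
dozen rational operations per term.  `torusBalance_eq` proves `Σ_p siteBalance = torusBalance`, so theorems are stated about the
model's own forms and only the evaluation (`native_decide`) sees the evaluator. [folklore]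
-/

/-- `evalQ` over a `flatMap` is the sum of the pieces (generic dimension). [folklore] -/
theorem evalQ_flatMapN {n : ℕ} {α : Type*} (l : List α) (f : α → List (Term n)) (u : Fin n → ℚ) :
    evalQ (l.flatMap f) u = (l.map fun a => evalQ (f a) u).sum := by
  induction l with
  | nil => simp
  | cons a l ih => rw [List.flatMap_cons, evalQ_append, ih, List.map_cons, List.sum_cons]

/-- Value of `(W y)_r` from the three rotation parameters `t0, t1, t2` (literally the coefficients of `WyG`). [folklore] -/
def WyVal (t0 t1 t2 : ℚ) (y : Fin 3 → ℚ) (r : Fin 3) : ℚ :=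
  Cmat y r 0 / gW r * t0 + Cmat y r 1 / gW r * t1 + Cmat y r 2 / gW r * t2

/-- `WyG` evaluates to `WyVal` of the evaluated rotation functionals. [folklore] -/
theorem eval_WyG {n : ℕ} (ths : List (LinF n)) (y : Fin 3 → ℚ) (r : Fin 3) (u : Fin n → ℚ) :
    (WyG ths y r).eval u = WyVal ((ths.getD 0 []).eval u) ((ths.getD 1 []).eval u) ((ths.getD 2 []).eval u) y r := by
  simp only [WyG, eval_compressN, LinF.eval_append, LinF.eval_smul, WyVal]

/-- `WyVal` in closed form: `(W y)_0 = y₁t₀ + y₂t₁`, `(W y)_1 = (y₂t₂ − y₀t₀)/3`, `(W y)_2 = −(y₀t₁ + y₁t₂)`. [folklore] -/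
theorem WyVal_explicit (t0 t1 t2 : ℚ) (y : Fin 3 → ℚ) :
    WyVal t0 t1 t2 y 0 = y 1 * t0 + y 2 * t1 ∧ WyVal t0 t1 t2 y 1 = (y 2 * t2 - y 0 * t0) / 3 ∧
      WyVal t0 t1 t2 y 2 = -(y 0 * t1 + y 1 * t2) := by
  simp only [WyVal, Cmat, gW, Fin.isValue]
  refine ⟨?_, ?_, ?_⟩ <;> simp <;> ring

/-- If-over-parity selects the plan of that parity. [folklore] -/
theorem if_parity_eq {α : Type*} (b : Bool) (f : Bool → α) : (if b = true then f true else f false) = f b := by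
  cases b <;> rfl

/-! #### Per-parity plans (site- and `u`-independent data, computed once) -/

/-- SUPPLY plan of parity `b`: for every offset `d` in range, `(d, y₀, y₁, y₂, w₁, w₂)` with `y = V b d`,
`w₁ = rnd 60 (W′(‖y‖²))`, `w₂ = rnd 60 (W″(‖y‖²))`. [folklore] -/
def supplyPlan (b : Bool) : List (Off × ℚ × ℚ × ℚ × ℚ × ℚ) :=
  (offsets b Rc2).map fun d =>
    let y := V b d
    (d, y 0, y 1, y 2, rnd 60 (ljW1 (ipG y y)), rnd 60 (ljW2 (ipG y y)))

/-- κ plan of parity `b`: the 12 shell offsets with their relative positions. [folklore] -/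
def kappaPlan (b : Bool) : List (Off × ℚ × ℚ × ℚ) :=
  (shell b).map fun s =>
    let y := V b s
    (s, y 0, y 1, y 2)

/-- READOUT plan of parity `b`: one record `(d, s, β, ys₀, ys₁, ys₂)` per bond `(p+d, p+d+s)` that carries a readout term
(same selection as `readoutTermsG`: `β ≠ 0` and far end within the cut-off). [folklore] -/
def readoutPlan (b : Bool) (btab : List ((Bool × Off × Off) × ℚ)) : List (Off × Off × ℚ × ℚ × ℚ × ℚ) :=
  (((0, 0, 0) : Off) :: offsets b Rc2).flatMap fun d =>
    let bq := if d.1 % 2 = 0 then b else !b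
    let yq := V b d
    Y1.flatMap fun s =>
      let bv := betaLookup btab bq (negOff d) s
      let ys := V true s
      if bv = 0 then [] else
        if ipG (fun c => yq c + ys c) (fun c => yq c + ys c) ≤ Rc2 then [(d, s, bv, ys 0, ys 1, ys 2)] else []

/-- Evaluating a concatenation (`flatMap`) of sparse functionals. [folklore] -/
theorem LinF.eval_flatMap {n : ℕ} {α : Type*} (l : List α) (f : α → LinF n) (u : Fin n → ℚ) :
    LinF.eval (l.flatMap f) u = (l.map fun a => (f a).eval u).sum := by
  induction l with
  | nil => simp
  | cons a l ih => rw [List.flatMap_cons, LinF.eval_append, ih, List.map_cons, List.sum_cons]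

/-- θ plan of parity `b`: for every shell offset `s` and component `r` the three coefficients
`(J⁻¹)_{k·} · C_{V s}[r][·]`, `k = 0, 1, 2` (the exact inverse `inv3 (Jmat b)` is evaluated here, once per parity, instead of
once per coefficient as in the term lists). [folklore] -/
def thetaPlan (b : Bool) : List (Off × Fin 3 × ℚ × ℚ × ℚ) :=
  let Ji := inv3 (Jmat b)
  (shell b).flatMap fun s => [(0 : Fin 3), 1, 2].map fun r =>
    (s, r, Ji 0 0 * Cmat (V b s) r 0 + Ji 0 1 * Cmat (V b s) r 1 + Ji 0 2 * Cmat (V b s) r 2,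
      Ji 1 0 * Cmat (V b s) r 0 + Ji 1 1 * Cmat (V b s) r 1 + Ji 1 2 * Cmat (V b s) r 2,
      Ji 2 0 * Cmat (V b s) r 0 + Ji 2 1 * Cmat (V b s) r 1 + Ji 2 2 * Cmat (V b s) r 2)

/-- Select the `k`-th of three coefficients. [folklore] -/
def sel3 (k : Fin 3) (c0 c1 c2 : ℚ) : ℚ := if k = 0 then c0 else if k = 1 then c1 else c2

section Fast

variable (NK N1 : ℕ) [NeZero NK] [NeZero N1]

omit [NeZero NK] [NeZero N1] in
/-- `eRelG p q c` evaluates to `u_(q,c) − u_(p,c)`. [folklore] -/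
theorem eval_eRelG (p q : SiteG NK N1) (c : Fin 3) (u : Fin (dimG NK N1) → ℚ) :
    (eRelG NK N1 p q c).eval u = u (idxG NK N1 q c) - u (idxG NK N1 p c) := by
  simp [eRelG]
  ring

omit [NeZero NK] [NeZero N1] in
/-- `residG` evaluates to the relative displacement minus `WyVal`. [folklore] -/
theorem eval_residG (ths : List (LinF (dimG NK N1))) (m q : SiteG NK N1) (y : Fin 3 → ℚ) (c : Fin 3)
    (u : Fin (dimG NK N1) → ℚ) :
    (residG NK N1 ths m q y c).eval u = u (idxG NK N1 q c) - u (idxG NK N1 m c) -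
      WyVal ((ths.getD 0 []).eval u) ((ths.getD 1 []).eval u) ((ths.getD 2 []).eval u) y c := by
  simp only [residG, LinF.eval_sub, eval_eRelG, eval_WyG]

omit [NeZero NK] [NeZero N1] in
/-- `dotGN y (eRelG m q ·)` evaluates to `⟨y, u_q − u_m⟩_G`. [folklore] -/
theorem eval_dotGN_eRelG (y : Fin 3 → ℚ) (m q : SiteG NK N1) (u : Fin (dimG NK N1) → ℚ) :
    (dotGN y fun c => eRelG NK N1 m q c).eval u = gW 0 * y 0 * (u (idxG NK N1 q 0) - u (idxG NK N1 m 0)) +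
      gW 1 * y 1 * (u (idxG NK N1 q 1) - u (idxG NK N1 m 1)) + gW 2 * y 2 * (u (idxG NK N1 q 2) - u (idxG NK N1 m 2)) := by
  simp only [dotGN, LinF.eval_add, LinF.eval_smul, eval_eRelG]
  ring

/-- The rotation parameter `θ_k(u)` of site `p` (as the term lists see it). [folklore] -/
def thetaVal (p : SiteG NK N1) (u : Fin (dimG NK N1) → ℚ) (k : ℕ) : ℚ := ((thetaListG NK N1 p).getD k []).eval u

/-- `θ_k(u)` of site `p` from the θ plan of its parity. [folklore] -/
def thetaFast (plan : List (Off × Fin 3 × ℚ × ℚ × ℚ)) (p : SiteG NK N1) (u : Fin (dimG NK N1) → ℚ) (k : Fin 3) : ℚ :=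
  (plan.map fun r => sel3 k r.2.2.1 r.2.2.2.1 r.2.2.2.2 * (u (idxG NK N1 (taddG NK N1 p r.1) r.2.1) - u (idxG NK N1 p r.2.1))).sum

/-- The θ functional evaluates to `thetaFast`. [folklore] -/
theorem eval_thetaG (p : SiteG NK N1) (u : Fin (dimG NK N1) → ℚ) (k : Fin 3) :
    (thetaG NK N1 p k).eval u = thetaFast NK N1 (thetaPlan (parityG NK N1 p)) p u k := by
  simp only [thetaG, thetaFast, thetaPlan, eval_compressN, LinF.eval_flatMap, sum_map_flatMap, List.map_map]
  congr 1
  refine List.map_congr_left fun s _ => ?_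
  congr 1
  refine List.map_congr_left fun r _ => ?_
  fin_cases k <;> simp [Function.comp, LinF.eval_smul, eval_eRelG, sel3]

/-- `thetaVal … k = thetaFast … k` for `k = 0, 1, 2`. [folklore] -/
theorem thetaVal_eq_fast (p : SiteG NK N1) (u : Fin (dimG NK N1) → ℚ) :
    thetaVal NK N1 p u 0 = thetaFast NK N1 (thetaPlan (parityG NK N1 p)) p u 0 ∧
      thetaVal NK N1 p u 1 = thetaFast NK N1 (thetaPlan (parityG NK N1 p)) p u 1 ∧
      thetaVal NK N1 p u 2 = thetaFast NK N1 (thetaPlan (parityG NK N1 p)) p u 2 := by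
  refine ⟨?_, ?_, ?_⟩ <;> rw [← eval_thetaG] <;> rfl

/-- Co-rotated squared residual `‖u_q − u_m − W y‖²_G` and elongation `⟨y, u_q − u_m⟩_G` of one bond, from values. [folklore] -/
def bondVals (u : Fin (dimG NK N1) → ℚ) (m q : SiteG NK N1) (t0 t1 t2 y0 y1 y2 : ℚ) : ℚ × ℚ :=
  let e0 := u (idxG NK N1 q 0) - u (idxG NK N1 m 0)
  let e1 := u (idxG NK N1 q 1) - u (idxG NK N1 m 1)
  let e2 := u (idxG NK N1 q 2) - u (idxG NK N1 m 2)
  let r0 := e0 - (y1 * t0 + y2 * t1)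
  let r1 := e1 - (y2 * t2 - y0 * t0) / 3
  let r2 := e2 + (y0 * t1 + y1 * t2)
  (r0 * r0 + 3 * (r1 * r1) + r2 * r2, y0 * e0 + 3 * (y1 * e1) + y2 * e2)

/-- SUPPLY of site `p` from its plan. [folklore] -/
def evalSupply (plan : List (Off × ℚ × ℚ × ℚ × ℚ × ℚ)) (p : SiteG NK N1) (t0 t1 t2 : ℚ) (u : Fin (dimG NK N1) → ℚ) : ℚ :=
  (plan.map fun r =>
    let v := bondVals NK N1 u p (taddG NK N1 p r.1) t0 t1 t2 r.2.1 r.2.2.1 r.2.2.2.1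
    r.2.2.2.2.1 / 2 * v.1 + r.2.2.2.2.2 * v.2 ^ 2).sum

/-- κ-DEMAND of site `p` from its plan. [folklore] -/
def evalKappa (plan : List (Off × ℚ × ℚ × ℚ)) (p : SiteG NK N1) (t0 t1 t2 : ℚ) (u : Fin (dimG NK N1) → ℚ) : ℚ :=
  (plan.map fun r =>
    let v := bondVals NK N1 u p (taddG NK N1 p r.1) t0 t1 t2 r.2.1 r.2.2.1 r.2.2.2
    kappa1 * v.2 ^ 2 + kappa3 * v.1).sum

/-- READOUT FORM of site `p` from its plan. [folklore] -/
def evalReadout (plan : List (Off × Off × ℚ × ℚ × ℚ × ℚ)) (p : SiteG NK N1) (t0 t1 t2 : ℚ) (u : Fin (dimG NK N1) → ℚ) :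
    ℚ :=
  (plan.map fun r =>
    let q := taddG NK N1 p r.1
    let v := bondVals NK N1 u q (taddG NK N1 q r.2.1) t0 t1 t2 r.2.2.2.1 r.2.2.2.2.1 r.2.2.2.2.2
    r.2.2.1 / 2 * v.1).sum

omit [NeZero NK] [NeZero N1] in
/-- The value-level bond quantities agree with the evaluated functionals. [folklore] -/
theorem bondVals_eq (u : Fin (dimG NK N1) → ℚ) (m q : SiteG NK N1) (t0 t1 t2 : ℚ) (y : Fin 3 → ℚ) :
    bondVals NK N1 u m q t0 t1 t2 (y 0) (y 1) (y 2) =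
      (gW 0 * (u (idxG NK N1 q 0) - u (idxG NK N1 m 0) - WyVal t0 t1 t2 y 0) ^ 2 +
        gW 1 * (u (idxG NK N1 q 1) - u (idxG NK N1 m 1) - WyVal t0 t1 t2 y 1) ^ 2 +
        gW 2 * (u (idxG NK N1 q 2) - u (idxG NK N1 m 2) - WyVal t0 t1 t2 y 2) ^ 2,
      gW 0 * y 0 * (u (idxG NK N1 q 0) - u (idxG NK N1 m 0)) + gW 1 * y 1 * (u (idxG NK N1 q 1) - u (idxG NK N1 m 1)) +
        gW 2 * y 2 * (u (idxG NK N1 q 2) - u (idxG NK N1 m 2))) := by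
  obtain ⟨h0, h1, h2⟩ := WyVal_explicit t0 t1 t2 y
  simp only [bondVals, h0, h1, h2, gW, Fin.isValue, Prod.mk.injEq]
  constructor <;> simp <;> ring

/-- `supplyS` from the supply plan. [folklore] -/
theorem supplyS_eq_eval (p : SiteG NK N1) (u : Fin (dimG NK N1) → ℚ) :
    supplyS NK N1 p u = evalSupply NK N1 (supplyPlan (parityG NK N1 p)) p (thetaVal NK N1 p u 0) (thetaVal NK N1 p u 1)
      (thetaVal NK N1 p u 2) u := by
  simp only [supplyS, supplyTermsG, evalSupply, supplyPlan, evalQ_flatMapN, List.map_map]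
  congr 1
  refine List.map_congr_left fun d _ => ?_
  simp only [Function.comp, evalQ_cons, evalQ_nil, sqN, eval_residG, eval_dotGN_eRelG, thetaVal, bondVals_eq]
  ring

/-- `kappaS` from the κ plan. [folklore] -/
theorem kappaS_eq_eval (p : SiteG NK N1) (u : Fin (dimG NK N1) → ℚ) :
    kappaS NK N1 p u = evalKappa NK N1 (kappaPlan (parityG NK N1 p)) p (thetaVal NK N1 p u 0) (thetaVal NK N1 p u 1)
      (thetaVal NK N1 p u 2) u := by
  simp only [kappaS, kappaTermsG, evalKappa, kappaPlan, evalQ_flatMapN, List.map_map]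
  congr 1
  refine List.map_congr_left fun s _ => ?_
  simp only [Function.comp, evalQ_cons, evalQ_nil, sqN, eval_residG, eval_dotGN_eRelG, thetaVal, bondVals_eq]
  ring

/-- `readoutS` from the readout plan. [folklore] -/
theorem readoutS_eq_eval (p : SiteG NK N1) (u : Fin (dimG NK N1) → ℚ) :
    readoutS NK N1 p u = evalReadout NK N1 (readoutPlan (parityG NK N1 p) betaTable) p (thetaVal NK N1 p u 0)
      (thetaVal NK N1 p u 1) (thetaVal NK N1 p u 2) u := by
  simp only [readoutS, readoutTermsG, evalReadout, readoutPlan, evalQ_flatMapN, sum_map_flatMap]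
  congr 1
  refine List.map_congr_left fun d _ => ?_
  congr 1
  refine List.map_congr_left fun s _ => ?_
  split_ifs <;>
    simp only [evalQ_cons, evalQ_nil, sqN, eval_residG, thetaVal, List.map_cons, List.map_nil, List.sum_cons, List.sum_nil,
      bondVals_eq] <;> ring

/-- **Whole-torus balance** `Σ_p [S_p + meanProj − λ·K_p − R_p](u)` evaluated from the plans (each plan computed once). [folklore] -/
def torusBalance (lam : ℚ) (u : Fin (dimG NK N1) → ℚ) : ℚ :=
  let spA := supplyPlan true
  let spB := supplyPlan false
  let kpA := kappaPlan true
  let kpB := kappaPlan false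
  let rpA := readoutPlan true betaTable
  let rpB := readoutPlan false betaTable
  let tpA := thetaPlan true
  let tpB := thetaPlan false
  let mp := meanProjS NK N1 u
  ((allSitesG NK N1).map fun p =>
    let b := parityG NK N1 p
    let t0 := thetaFast NK N1 (if b = true then tpA else tpB) p u 0
    let t1 := thetaFast NK N1 (if b = true then tpA else tpB) p u 1
    let t2 := thetaFast NK N1 (if b = true then tpA else tpB) p u 2
    evalSupply NK N1 (if b = true then spA else spB) p t0 t1 t2 u + mp -
      lam * evalKappa NK N1 (if b = true then kpA else kpB) p t0 t1 t2 u -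
      evalReadout NK N1 (if b = true then rpA else rpB) p t0 t1 t2 u).sum

/-- **The evaluator IS the site-balance sum**: `Σ_p siteBalance λ p u = torusBalance λ u`. [folklore] -/
theorem torusBalance_eq (lam : ℚ) (u : Fin (dimG NK N1) → ℚ) :
    ∑ p : SiteG NK N1, siteBalance NK N1 lam p u = torusBalance NK N1 lam u := by
  rw [← allSitesG_sum, torusBalance]
  congr 1
  refine List.map_congr_left fun p _ => ?_
  obtain ⟨h0, h1, h2⟩ := thetaVal_eq_fast NK N1 p u
  simp only [if_parity_eq (parityG NK N1 p) supplyPlan, if_parity_eq (parityG NK N1 p) kappaPlan,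
    if_parity_eq (parityG NK N1 p) (fun b => readoutPlan b betaTable), if_parity_eq (parityG NK N1 p) thetaPlan,
    siteBalance, supplyS_eq_eval, kappaS_eq_eval, readoutS_eq_eval, h0, h1, h2]

/-- A negative evaluator value certifies a negative site-balance sum. [folklore] -/
theorem siteSum_neg_of_torusBalance_neg (lam : ℚ) (u : Fin (dimG NK N1) → ℚ) (h : torusBalance NK N1 lam u < 0) :
    ∑ p : SiteG NK N1, siteBalance NK N1 lam p u < 0 := by
  rwa [torusBalance_eq]

end Fast

end Summit.AtomisticToContinuum.Crystallization.Theorems.StrictSplittingRuleTorusLMI
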